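import Literature.NumberTheory.QuadraticFields.BinaryQuadraticFormsClassNumber
import Mathlib.LinearAlgebra.Matrix.Adjugate
import Mathlib.LinearAlgebra.Matrix.Trace
import Mathlib.LinearAlgebra.Matrix.Notation
import HarnessLib

/-!
# Hertling–Larabi 2026b LEMMA 7.2 (b): integer `2 × 2` matrices of fixed trace ↔ binary quadratic forms
# (`(a b; c d) ↦ [c, d − a, −b]`), `SL₂(ℤ)`-conjugacy classes ↔ proper equivalence classes,
# `GL₂(ℤ)`-conjugacy classes ↔ `GL₂(ℤ)`-equivalence classes

[topic LinearAlgebra/Matrix] The rank-2 bridge between the `GLₙ(ℤ)`-conjugacy files (`LatimerMacDuffee*`: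
classes `PB = B'P`, `P` unimodular) and the tree's binary quadratic forms
(`Literature.NumberTheory.QuadraticFields.Quadratic.BinQF` of `BinaryQuadraticFormsClassNumber`: `⟨a, b, c⟩`
is `ax² + bxy + cy²`, `f.act p q r s = f(px + qy, rx + sy)`, `ProperEquiv f g :⟺ g = f·γ`, `det γ = 1`).
Lane `lit-hodgefound` (Track 2 foundations library), seat p19 generation 38, row g38-#4.  THEOREMS ONLY: no
definition, no instance, no notation, no named fact (D-0026, net Literature debt `0`), no `sorry`.  The map is
written in place: the form of `B` is `(⟨B 1 0, B 1 1 - B 0 0, -B 0 1⟩ : BinQF)`, i.e. `[c, d − a, −b]` for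
`B = (a b; c d)` (`binQF_of`).

## Source, VERBATIM

C. Hertling, K. Larabi, *Conjugacy classes of regular integer matrices*, arXiv:2602.15748 (2026)
[HertlingLarabi2026b], held `paper:arxiv-2602.15748`, §7.1 (chunk p0014):
«**Definition 7.1.** […] (b) A binary quadratic form `q` is a map `q = [a, h, b]_{quad} : ℤ² → ℤ` with
`q(x) = ax_1² + hx_1x_2 + bx_2²` for some `a, h, b ∈ ℤ`. (c) Two binary quadratic forms `q_1` and `q_2` are properly
equivalent if a matrix `A ∈ SL_2(ℤ)` with `q_2(x) = q_1(Ax)` exists. They are `GL_2(ℤ)`-equivalent if a matrix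
`A ∈ GL_2(ℤ)` with `q_2(x) = det A · q_1(Ax)` exists.
**Lemma 7.2.** […] (b) Fix `r ∈ ℤ`. There is a 1:1 correspondence between matrices `A ∈ M_{2×2}(ℤ)` with trace
`A = r` and binary quadratic forms. It maps `B = (a b; c d)` to `[c, d − a, −b]_{quad}`. One `SL_2(ℤ)`-conjugacy
class is mapped to one proper equivalence class. One `GL_2(ℤ)`-conjugacy class is mapped to one
`GL_2(ℤ)`-equivalence class.
Proof: […] (b) Consider the injective map `Ψ : {B ∈ M_{2×2}(ℤ) | tr B = r} → {C ∈ M_{2×2}(½ℤ) | Cᵗ = C}`,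
`B = (a b; c d) ↦ Ψ(B) := (B − (r/2)E_2)ᵗ (0 −1; 1 0) = (c (d−a)/2; (d−a)/2 −b)`. `Ψ(B)` is equivalent to
`[c, d − a, −b]_{sym}` and to `[c, d − a, −b]_{quad}`. One recovers `B` from `Ψ(B)` and `tr B = r`. Recall
`SL_2(ℤ) = Sp_2(ℤ)` and the generalization to `GL_2(ℤ)`, `Aᵗ (0 −1; 1 0) A = det A · (0 −1; 1 0)` for
`A ∈ GL_2(ℤ)`. It implies for `A ∈ GL_2(ℤ)` `Ψ(A⁻¹BA) = Aᵗ(B − (r/2)E_2)ᵗA^{−t} (0 −1; 1 0) = det A · AᵗΨ(B)A`. □»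
Remarks 7.5 (ii) (chunk p0015): «This is possible as the type of a matrix `B ∈ M_{2×2}(ℤ)` does not change if one
adds a multiple of `E_2`.»  Def./Lemma 6.1 (e) (chunk p0012): «`[B]_ℤ := {C⁻¹BC | C ∈ GL_n(ℤ)}`».

## What is proved

* §1 the map: `binQF_of` (`(a b; c d) ↦ [c, d − a, −b]`), **`eval_eq_det` — the form of `B` is
  `v ↦ det(v | Bv)`** (which is how `Ψ(A⁻¹BA) = det A · AᵗΨ(B)A` is proved here), `disc_eq` (discriminant
  `(tr B)² − 4 det B` = that of `p_B`), `binQF_add_smul_one` (invariance under `B ↦ B + kE_2`, Rem. 7.5 (ii)),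
  **`eq_of_trace_eq_of_binQF_eq`** («One recovers `B` from `Ψ(B)` and `tr B = r`»), `even_b_sub_trace` and
  **`exists_trace_eq_and_binQF_eq_iff`** (for fixed trace `r` the image is exactly the forms `[α, h, β]` with
  `h ≡ r (mod 2)` — HL's «1:1 correspondence […] and binary quadratic forms» with the parity condition, implicit
  in the printed statement, made explicit).
* §2 equivariance: **`binQF_adjugate_mul_mul`, `binQF_adjugate_of_mul_mul` — the form of `adj(γ)Bγ` is the form
  of `B` composed with `γ`**, for every integer `γ` (for `γ ∈ SL₂(ℤ)`: `adj γ = γ⁻¹`); `trace_adjugate_mul_mul`;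
  `eq_smul_adjugate_mul_mul`, `mul_smul_adjugate_mul_mul` (`γB' = Bγ ⟺ B' = det γ · adj(γ)Bγ` for `(det γ)² = 1`);
  `binQF_smul`.
* §3 **LEMMA 7.2 (b) on classes**: **`exists_sl_conj_iff_properEquiv`** — for `B, B'` of the same trace,
  `B' ∈ [B]_{SL₂(ℤ)}` (`γB' = Bγ`, `det γ = 1`) iff the forms are properly equivalent (`BinQF.ProperEquiv`);
  **`exists_gl_conj_iff`** — `B' ∈ [B]_{GL₂(ℤ)}` (`(det γ)² = 1`) iff `q_{B'}(x) = det γ · q_B(γx)` for some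
  `γ ∈ GL₂(ℤ)` (Def. 7.1 (c)); `isUnit_det_iff_sq_eq_one` (the unimodularity `IsUnit (det P)` of the
  `LatimerMacDuffee*` files ⟺ `(det P)² = 1`).
NOT here: Lemma 7.2 (a) (forms ↔ symmetric bilinear forms with values in `½ℤ`), Rem. 7.3 (ii) (orientations and
`(ε+)`-classes), the types I–V (Lemma 7.6) and §§7.2–7.4.

## References

* [HertlingLarabi2026b] C. Hertling, K. Larabi, arXiv:2602.15748 (2026), §7.1 Def. 7.1 (b)(c), Lemma 7.2 (b) and
  proof (chunk p0014), Rem. 7.5 (ii) (chunk p0015), §6 Def./Lemma 6.1 (e) (chunk p0012).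
  [cite: HertlingLarabi2026b, §7.1 Lemma 7.2 (b), chunk p0014]
* [Cox2013] D. A. Cox, *Primes of the form x² + ny²*, 2nd ed., §2.A (the tree's `BinQF`, `act`, `ProperEquiv`).
-/

namespace Literature.LinearAlgebra.Matrix.IntegerMatrixBinQF

open Literature.NumberTheory.QuadraticFields.Quadratic (BinQF)
open Literature.NumberTheory.QuadraticFields.Quadratic.BinQF

/-! ## §1 The map `B = (a b; c d) ↦ [c, d − a, −b]_quad` -/

/-- **LEMMA 7.2 (b), the map on a concrete matrix: `(a b; c d) ↦ [c, d − a, −b]_quad`.**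
[cite: HertlingLarabi2026b, §7.1 Lemma 7.2 (b), chunk p0014] -/
theorem binQF_of (a b c d : ℤ) :
    (⟨(!![a, b; c, d] : Matrix (Fin 2) (Fin 2) ℤ) 1 0,
      (!![a, b; c, d] : Matrix (Fin 2) (Fin 2) ℤ) 1 1 - (!![a, b; c, d] : Matrix (Fin 2) (Fin 2) ℤ) 0 0,
      -(!![a, b; c, d] : Matrix (Fin 2) (Fin 2) ℤ) 0 1⟩ : BinQF) = ⟨c, d - a, -b⟩ := by
  simp

/-- **The form of `B` is `v ↦ det(v | Bv)`**: `[c, d − a, −b]_quad(x, y) = det (x, (Bv)_1; y, (Bv)_2)` for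
`v = (x, y)ᵗ` — whence its `GL₂(ℤ)`-behaviour (HL: `Ψ(B) = (B − r/2·E_2)ᵗ (0 −1; 1 0)`).
[cite: HertlingLarabi2026b, §7.1 Lemma 7.2 (b) and proof, chunk p0014] -/
theorem eval_eq_det (B : Matrix (Fin 2) (Fin 2) ℤ) (x y : ℤ) :
    (⟨B 1 0, B 1 1 - B 0 0, -B 0 1⟩ : BinQF).eval x y =
      Matrix.det !![x, B.mulVec ![x, y] 0; y, B.mulVec ![x, y] 1] := by
  rw [Matrix.det_fin_two_of]
  simp [BinQF.eval, Matrix.mulVec, dotProduct, Fin.sum_univ_two]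
  ring

/-- **The discriminant of the form of `B` is `(tr B)² − 4 det B`** (the discriminant of the characteristic
polynomial `t² − (tr B)t + det B`). [cite: HertlingLarabi2026b, §7.1 Lemma 7.2 (b) with Rem. 7.3, chunk p0014] -/
theorem disc_eq (B : Matrix (Fin 2) (Fin 2) ℤ) :
    (⟨B 1 0, B 1 1 - B 0 0, -B 0 1⟩ : BinQF).disc = Matrix.trace B ^ 2 - 4 * B.det := by
  rw [Matrix.trace_fin_two, Matrix.det_fin_two]
  simp only [BinQF.disc]
  ring

/-- The middle coefficient `d − a` has the parity of the trace `a + d`. [cite: HertlingLarabi2026b, §7.1 Lemma 7.2 (b), chunk p0014] -/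
theorem even_b_sub_trace (B : Matrix (Fin 2) (Fin 2) ℤ) :
    Even ((⟨B 1 0, B 1 1 - B 0 0, -B 0 1⟩ : BinQF).b - Matrix.trace B) := by
  rw [Matrix.trace_fin_two]
  exact ⟨-B 0 0, by ring⟩

/-- **Adding a multiple of `E_2` does not change the form** («the type of a matrix `B ∈ M_{2×2}(ℤ)` does not
change if one adds a multiple of `E_2`», Rem. 7.5 (ii)) — so the trace must be fixed for a 1:1 correspondence.
[cite: HertlingLarabi2026b, §7.1 Rem. 7.5 (ii), chunk p0015] -/
theorem binQF_add_smul_one (B : Matrix (Fin 2) (Fin 2) ℤ) (k : ℤ) :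
    (⟨(B + k • (1 : Matrix (Fin 2) (Fin 2) ℤ)) 1 0,
      (B + k • (1 : Matrix (Fin 2) (Fin 2) ℤ)) 1 1 - (B + k • (1 : Matrix (Fin 2) (Fin 2) ℤ)) 0 0,
      -(B + k • (1 : Matrix (Fin 2) (Fin 2) ℤ)) 0 1⟩ : BinQF) = ⟨B 1 0, B 1 1 - B 0 0, -B 0 1⟩ := by
  have h10 : (1 : Matrix (Fin 2) (Fin 2) ℤ) 1 0 = 0 := Matrix.one_apply_ne (by decide)
  have h01 : (1 : Matrix (Fin 2) (Fin 2) ℤ) 0 1 = 0 := Matrix.one_apply_ne (by decide)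
  have h00 : (1 : Matrix (Fin 2) (Fin 2) ℤ) 0 0 = 1 := Matrix.one_apply_eq 0
  have h11 : (1 : Matrix (Fin 2) (Fin 2) ℤ) 1 1 = 1 := Matrix.one_apply_eq 1
  ext <;> simp only [Matrix.add_apply, Matrix.smul_apply, h10, h01, h00, h11, smul_eq_mul, mul_zero, add_zero,
    mul_one]
  ring

/-- **LEMMA 7.2 (b), injectivity for fixed trace**: «One recovers `B` from `Ψ(B)` and `tr B = r`.»
[cite: HertlingLarabi2026b, §7.1 Lemma 7.2 (b) (proof), chunk p0014] -/
theorem eq_of_trace_eq_of_binQF_eq {B B' : Matrix (Fin 2) (Fin 2) ℤ} (htr : Matrix.trace B = Matrix.trace B')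
    (h : (⟨B 1 0, B 1 1 - B 0 0, -B 0 1⟩ : BinQF) = ⟨B' 1 0, B' 1 1 - B' 0 0, -B' 0 1⟩) : B = B' := by
  rw [Matrix.trace_fin_two, Matrix.trace_fin_two] at htr
  simp only [BinQF.mk.injEq, neg_inj] at h
  obtain ⟨h10, h11, h01⟩ := h
  ext i j
  fin_cases i <;> fin_cases j
  · change B 0 0 = B' 0 0; omega
  · exact h01
  · exact h10
  · change B 1 1 = B' 1 1; omega

/-- **LEMMA 7.2 (b), the image for fixed trace `r`: exactly the forms `[α, h, β]` with `h ≡ r (mod 2)`**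
(«There is a 1:1 correspondence between matrices `A ∈ M_{2×2}(ℤ)` with trace `A = r` and binary quadratic
forms» — those of discriminant `≡ r² (mod 4)`; the preimage of `[α, h, β]` is `((r−h)/2 −β; α (r+h)/2)`).
[cite: HertlingLarabi2026b, §7.1 Lemma 7.2 (b), chunk p0014] -/
theorem exists_trace_eq_and_binQF_eq_iff (q : BinQF) (r : ℤ) :
    (∃ B : Matrix (Fin 2) (Fin 2) ℤ, Matrix.trace B = r ∧ (⟨B 1 0, B 1 1 - B 0 0, -B 0 1⟩ : BinQF) = q) ↔
      Even (q.b - r) := by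
  constructor
  · rintro ⟨B, rfl, rfl⟩
    exact even_b_sub_trace B
  · obtain ⟨a, h, b⟩ := q
    rintro ⟨k, hk⟩
    refine ⟨!![-k, -b; a, r + k], by rw [Matrix.trace_fin_two_of]; ring, ?_⟩
    rw [binQF_of]
    simp only [BinQF.mk.injEq, neg_neg]
    refine ⟨trivial, ?_, trivial⟩
    linear_combination -hk

/-! ## §2 Equivariance: `Ψ(A⁻¹BA) = det A · Aᵗ Ψ(B) A` -/

/-- **LEMMA 7.2 (b), equivariance (proof: «`Ψ(A⁻¹BA) = det A · AᵗΨ(B)A`»)** — for EVERY integer matrix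
`γ = (p q; r s)`: the form of `adj(γ)·B·γ` is the form of `B` composed with `γ`, `q_{adj(γ)Bγ}(v) = q_B(γv)`
(`= det(γv | Bγv)`); for `γ ∈ SL₂(ℤ)`, `adj(γ) = γ⁻¹`. [cite: HertlingLarabi2026b, §7.1 Lemma 7.2 (b) (proof), chunk p0014] -/
theorem binQF_adjugate_of_mul_mul (B : Matrix (Fin 2) (Fin 2) ℤ) (p q r s : ℤ) :
    (⟨((!![p, q; r, s] : Matrix (Fin 2) (Fin 2) ℤ).adjugate * B * !![p, q; r, s]) 1 0,
        ((!![p, q; r, s] : Matrix (Fin 2) (Fin 2) ℤ).adjugate * B * !![p, q; r, s]) 1 1 -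
          ((!![p, q; r, s] : Matrix (Fin 2) (Fin 2) ℤ).adjugate * B * !![p, q; r, s]) 0 0,
        -((!![p, q; r, s] : Matrix (Fin 2) (Fin 2) ℤ).adjugate * B * !![p, q; r, s]) 0 1⟩ : BinQF) =
      (⟨B 1 0, B 1 1 - B 0 0, -B 0 1⟩ : BinQF).act p q r s := by
  rw [Matrix.adjugate_fin_two_of, Matrix.eta_fin_two B]
  simp only [Matrix.mul_fin_two, Matrix.of_apply, Matrix.cons_val', Matrix.cons_val_zero, Matrix.cons_val_one,
    Matrix.cons_val_fin_one, Matrix.empty_val']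
  ext <;> simp only [BinQF.act] <;> ring

/-- The same for a matrix variable `γ`: the form of `adj(γ)·B·γ` is the form of `B` composed with
`(γ₀₀ γ₀₁; γ₁₀ γ₁₁)`. [cite: HertlingLarabi2026b, §7.1 Lemma 7.2 (b) (proof), chunk p0014] -/
theorem binQF_adjugate_mul_mul (B γ : Matrix (Fin 2) (Fin 2) ℤ) :
    (⟨(γ.adjugate * B * γ) 1 0, (γ.adjugate * B * γ) 1 1 - (γ.adjugate * B * γ) 0 0,
        -(γ.adjugate * B * γ) 0 1⟩ : BinQF) =
      (⟨B 1 0, B 1 1 - B 0 0, -B 0 1⟩ : BinQF).act (γ 0 0) (γ 0 1) (γ 1 0) (γ 1 1) := by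
  conv_lhs => rw [Matrix.eta_fin_two γ]
  exact binQF_adjugate_of_mul_mul B (γ 0 0) (γ 0 1) (γ 1 0) (γ 1 1)

/-- `tr(adj(γ)·B·γ) = det γ · tr B`. [cite: HertlingLarabi2026b, §7.1 Lemma 7.2 (b) (proof), chunk p0014] -/
theorem trace_adjugate_mul_mul (B γ : Matrix (Fin 2) (Fin 2) ℤ) :
    Matrix.trace (γ.adjugate * B * γ) = γ.det * Matrix.trace B := by
  rw [Matrix.trace_mul_cycle, Matrix.mul_adjugate, Matrix.smul_mul, Matrix.one_mul, Matrix.trace_smul,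
    smul_eq_mul]

/-- For `γB' = Bγ` with `det γ = ε`, `ε² = 1` (`γ ∈ GL₂(ℤ)`): `B' = γ⁻¹Bγ = ε·adj(γ)·B·γ`.
[cite: HertlingLarabi2026b, §7.1 Lemma 7.2 (b) (proof), chunk p0014] -/
theorem eq_smul_adjugate_mul_mul {B B' γ : Matrix (Fin 2) (Fin 2) ℤ} (hε : γ.det ^ 2 = 1)
    (h : γ * B' = B * γ) : B' = γ.det • (γ.adjugate * B * γ) := by
  have h1 : γ.adjugate * (γ * B') = γ.adjugate * (B * γ) := by rw [h]
  rw [← Matrix.mul_assoc, Matrix.adjugate_mul, Matrix.smul_mul, Matrix.one_mul, ← Matrix.mul_assoc] at h1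
  rw [← h1, smul_smul, ← sq, hε, one_smul]

/-- Conversely `γ·(ε·adj(γ)·B·γ) = B·γ` for `det γ = ε`, `ε² = 1`. [cite: HertlingLarabi2026b, §7.1 Lemma 7.2 (b) (proof), chunk p0014] -/
theorem mul_smul_adjugate_mul_mul {B γ : Matrix (Fin 2) (Fin 2) ℤ} (hε : γ.det ^ 2 = 1) :
    γ * (γ.det • (γ.adjugate * B * γ)) = B * γ := by
  rw [Matrix.mul_smul, ← Matrix.mul_assoc, ← Matrix.mul_assoc, Matrix.mul_adjugate]
  simp only [Matrix.smul_mul, Matrix.one_mul, smul_smul]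
  rw [← sq, hε, one_smul]

/-- The form is `ℤ`-linear in `B`: `form(ε·M) = ε·form(M)`. [cite: HertlingLarabi2026b, §7.1 Lemma 7.2 (b), chunk p0014] -/
theorem binQF_smul (ε : ℤ) (M : Matrix (Fin 2) (Fin 2) ℤ) :
    (⟨(ε • M) 1 0, (ε • M) 1 1 - (ε • M) 0 0, -(ε • M) 0 1⟩ : BinQF) =
      ⟨ε * M 1 0, ε * (M 1 1 - M 0 0), ε * (-M 0 1)⟩ := by
  ext <;> simp only [Matrix.smul_apply, smul_eq_mul] <;> ring

/-! ## §3 LEMMA 7.2 (b): conjugacy classes ↔ equivalence classes -/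

/-- **LEMMA 7.2 (b): «One `SL₂(ℤ)`-conjugacy class is mapped to one proper equivalence class.»** For integer
`2 × 2` matrices `B, B'` of the SAME trace: `B' = γ⁻¹Bγ` for some `γ ∈ SL₂(ℤ)` iff the forms `[c, d−a, −b]` of
`B` and `B'` are properly equivalent (the tree's `BinQF.ProperEquiv`: `g = f·γ`, `det γ = 1`).
[cite: HertlingLarabi2026b, §7.1 Lemma 7.2 (b), chunk p0014] -/
theorem exists_sl_conj_iff_properEquiv {B B' : Matrix (Fin 2) (Fin 2) ℤ} (htr : Matrix.trace B = Matrix.trace B') :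
    (∃ γ : Matrix (Fin 2) (Fin 2) ℤ, γ.det = 1 ∧ γ * B' = B * γ) ↔
      (⟨B 1 0, B 1 1 - B 0 0, -B 0 1⟩ : BinQF).ProperEquiv ⟨B' 1 0, B' 1 1 - B' 0 0, -B' 0 1⟩ := by
  constructor
  · rintro ⟨γ, hdet, h⟩
    have hB' : B' = γ.adjugate * B * γ := by
      rw [eq_smul_adjugate_mul_mul (by rw [hdet, one_pow]) h, hdet, one_smul]
    refine ⟨γ 0 0, γ 0 1, γ 1 0, γ 1 1, by rw [← hdet, Matrix.det_fin_two], ?_⟩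
    rw [hB', binQF_adjugate_mul_mul]
  · rintro ⟨p, q, r, s, hdet, hg⟩
    have hγdet : (!![p, q; r, s] : Matrix (Fin 2) (Fin 2) ℤ).det = 1 := by
      rw [Matrix.det_fin_two_of]; linear_combination hdet
    have hB' : B' = (!![p, q; r, s] : Matrix (Fin 2) (Fin 2) ℤ).adjugate * B * !![p, q; r, s] := by
      refine eq_of_trace_eq_of_binQF_eq ?_ ?_
      · rw [trace_adjugate_mul_mul, hγdet, one_mul, htr]
      · rw [hg, binQF_adjugate_of_mul_mul]
    refine ⟨!![p, q; r, s], hγdet, ?_⟩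
    have h := mul_smul_adjugate_mul_mul (B := B) (γ := !![p, q; r, s]) (by rw [hγdet, one_pow])
    rwa [hγdet, one_smul, ← hB'] at h

/-- **LEMMA 7.2 (b): «One `GL₂(ℤ)`-conjugacy class is mapped to one `GL₂(ℤ)`-equivalence class.»** For integer
`2 × 2` matrices `B, B'` of the same trace: `B' = γ⁻¹Bγ` for some `γ ∈ GL₂(ℤ)` (`(det γ)² = 1`) iff
`q_{B'}(x) = det γ · q_B(γx)` for some `γ = (p q; r s) ∈ GL₂(ℤ)` (Def. 7.1 (c): «`GL_2(ℤ)`-equivalent if a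
matrix `A ∈ GL_2(ℤ)` with `q_2(x) = det A · q_1(Ax)` exists»).
[cite: HertlingLarabi2026b, §7.1 Def. 7.1 (c) and Lemma 7.2 (b), chunk p0014] -/
theorem exists_gl_conj_iff {B B' : Matrix (Fin 2) (Fin 2) ℤ} (htr : Matrix.trace B = Matrix.trace B') :
    (∃ γ : Matrix (Fin 2) (Fin 2) ℤ, γ.det ^ 2 = 1 ∧ γ * B' = B * γ) ↔
      ∃ p q r s : ℤ, (p * s - q * r) ^ 2 = 1 ∧
        (⟨B' 1 0, B' 1 1 - B' 0 0, -B' 0 1⟩ : BinQF) =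
          ⟨(p * s - q * r) * ((⟨B 1 0, B 1 1 - B 0 0, -B 0 1⟩ : BinQF).act p q r s).a,
            (p * s - q * r) * ((⟨B 1 0, B 1 1 - B 0 0, -B 0 1⟩ : BinQF).act p q r s).b,
            (p * s - q * r) * ((⟨B 1 0, B 1 1 - B 0 0, -B 0 1⟩ : BinQF).act p q r s).c⟩ := by
  constructor
  · rintro ⟨γ, hdet, h⟩
    have hB' := eq_smul_adjugate_mul_mul hdet h
    have hd : γ.det = γ 0 0 * γ 1 1 - γ 0 1 * γ 1 0 := Matrix.det_fin_two γ
    refine ⟨γ 0 0, γ 0 1, γ 1 0, γ 1 1, by rw [← hd]; exact hdet, ?_⟩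
    rw [← hd, hB', binQF_smul, ← binQF_adjugate_mul_mul B γ]
  · rintro ⟨p, q, r, s, hdet, hg⟩
    have hγdet : (!![p, q; r, s] : Matrix (Fin 2) (Fin 2) ℤ).det = p * s - q * r := by
      rw [Matrix.det_fin_two_of]
    have hsq : (!![p, q; r, s] : Matrix (Fin 2) (Fin 2) ℤ).det ^ 2 = 1 := by rw [hγdet, hdet]
    have hB' : B' = (!![p, q; r, s] : Matrix (Fin 2) (Fin 2) ℤ).det •
        ((!![p, q; r, s] : Matrix (Fin 2) (Fin 2) ℤ).adjugate * B * !![p, q; r, s]) := by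
      refine eq_of_trace_eq_of_binQF_eq ?_ ?_
      · rw [Matrix.trace_smul, trace_adjugate_mul_mul, smul_eq_mul, ← mul_assoc, ← sq, hsq, one_mul, htr]
      · rw [hg, binQF_smul, ← binQF_adjugate_of_mul_mul B p q r s, hγdet]
    exact ⟨!![p, q; r, s], hsq, by rw [hB', mul_smul_adjugate_mul_mul hsq]⟩

/-- `γ ∈ GL₂(ℤ)` iff `det γ = ±1` iff `(det γ)² = 1`: the unimodularity condition `IsUnit (det γ)` of the
`GLₙ(ℤ)`-conjugacy files (`LatimerMacDuffee*`) in the form used above.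
[cite: HertlingLarabi2026b, §6 Def./Lemma 6.1 (e), chunk p0012] -/
theorem isUnit_det_iff_sq_eq_one (γ : Matrix (Fin 2) (Fin 2) ℤ) : IsUnit γ.det ↔ γ.det ^ 2 = 1 := by
  rw [Int.isUnit_iff, sq_eq_one_iff]

end Literature.LinearAlgebra.Matrix.IntegerMatrixBinQF
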